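import Literature.NumberTheory.EllipticCurves.PastenValuationProductThm75Proofs
import Literature.NumberTheory.DiophantineGeometry.FaltingsHeight
import Literature.NumberTheory.EllipticCurves.CongruenceNumberLevelBound
import HarnessLib

/-!
# Pasten's spectral bound for the modular degree, `log δ_{1,N} ≤ (N/12 + (7/12) d(N²))(log N +
# 4 log N / log log N)`, and the height clauses of his Thm 7.5 (Pasten 2024, Thm 7.2 at `D = 1`, Thm 7.5)

Topic `Literature/NumberTheory/EllipticCurves` (family `abc`, LADDER-ABC A1, the *modular method*).
Named facts (`def … : Prop`, D-0014) for the two displays of §7 of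

* H. Pasten, *Shimura curves and the abc conjecture*, J. Number Theory **254** (2024) 214–335 =
  arXiv:1705.09251 [`PastenShimura2024`] (held TeX text, §7 pp. 26–27 of the arXiv version read; the
  numbering `Prop 7.1 / Thm 7.2 / Thm 7.5` is that of the arXiv text, as in the sibling files),

that the tree did not yet carry as statements although its proof files consume them:

* **Thm 7.2** (`D = 1`): *"Given any elliptic curve `E` over `ℚ` with conductor `N` and an admissible
  factorization `N = DM`, we have `log δ_{D,M}(E) ≤ ((1/12) φ(D) M + (7/12) d(DM²))(log N +
  4 log N / log log N)`. Furthermore, given any `ε > 0`, for `N ≫_ε 1` with an effective implicit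
  constant, we have `log δ_{D,M} < (1/24 + ε) φ(D) M log N`."* Vendored at `D = 1`, `M = N`
  (`δ_{1,N} = deg(X₀(N) → A)` the degree of the optimal quotient, p. 12), in the optimal-datum phrasing
  of `ModularForms.PastenShimura2024_thm_5_5` / `modularDegree_dvd_congruenceNumber`:
  `PastenShimura2024_thm_7_2_explicit`, `PastenShimura2024_thm_7_2_asymptotic` — the latter is
  LITERALLY the hypothesis `hδ` of `pasten_thm_7_5_of_modularity_of_optimalDegreeBound`
  (`PastenValuationProductThm75Proofs.lean`), whence the PROVED assembly `pasten_thm_7_5_of_thm_7_2`: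
  modularity + Mazur–Kenku + Thm 7.2 ⟹ `pasten_thm_7_5`. (The sibling
  `PastenValuationProductThm75AsymptoticProofs.lean` reduces the same `hδ` further to Thm 5.5, Deligne's
  bound and Murty's Lemma 11; it notes "Thm 7.2 is not vendored in the tree".)
  `-- TODO(general form): δ_{D,M}` for admissible `N = DM` needs the Shimura-curve degree
  `δ_{D,M}(E)`, cf. `Literature/NumberTheory/Automorphic/ShimuraCurveRibetTakahashi.lean`.
* **Thm 7.5, height clauses**: *"For all elliptic curves `E` over `ℚ` of conductor `N` we have
  `h(E) ≤ (1/24)(N + 7 d(N²))(log N + 4 log N / log log N) + 9` … Furthermore, given `ε > 0`, for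
  `N ≫_ε 1` … `h(E) < (1/48 + ε) N log N`"* — `PastenShimura2024_thm_7_5_height_explicit`,
  `PastenShimura2024_thm_7_5_height` (the discriminant clauses are the sibling facts
  `pasten_thm_7_5_explicit`, `pasten_thm_7_5` of `PastenValuationProduct.lean`, whose module docstring
  deferred the height halves: "no Faltings height in the tree yet" — it is there now,
  `WeierstrassCurve.faltingsHeight`, Faltings' = Silverman's = Pasten's normalisation,
  `faltingsHeight_eq_neg_half_log`). These are for ALL `E/ℚ` with an `ε`-uniform threshold, which the
  semistable-away-from-`S` statement `ModularForms.pasten2024_height_lt` (Thm 1.9 = Cor 7.8) does not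
  give. They improve Murty–Pasten 2013, Thm 7.1 (`MurtyPasten.faltingsHeight_lt`:
  `h < 0.1 N log N + 11`; `CongruenceNumberLevelBound.lean`).

Rendering: `E/ℚ` is `W : WeierstrassCurve ℚ` with `[W.IsElliptic]`; `N = W.conductorNorm ℤ` (in the
explicit statements the level of the datum is pinned to the conductor by a hypothesis, so that
`log log N > 0`: `N_E ≥ 11`); `d(n) = n.divisors.card`; `δ_{1,N}` = `D.modularDegree` for a datum `D`
minimal among all data at level `N` with the same newform (optimal quotient); the GRH clauses and the
"accessible error term" variants (Thm 7.7) are not recorded.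

## References

* [PastenShimura2024] H. Pasten, J. Number Theory 254 (2024) 214–335 = arXiv:1705.09251: §2 p. 12
  (`δ_{D,M}`, `δ_{1,N} = deg φ`), §3 (3.x) (`h(E) ≤ ½ log δ_{1,N} + 9`), Prop 7.1, Thm 7.2 (p. 26),
  Thm 7.5 (p. 27).
* [MurtyPasten2013] M. R. Murty, H. Pasten, J. Number Theory 133 (2013), Thm 4.3 / 7.1 (the earlier
  `(1/5) N log N` and `0.1 N log N + 11`).
-/

noncomputable section

open WeierstrassCurve

namespace Literature.NumberTheory.EllipticCurves

open ModularForms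

/-! ### Thm 7.2 at `D = 1`: the spectral bound for `δ_{1,N}` -/

/-- **Pasten 2024, Theorem 7.2, explicit clause, at `D = 1`.** For every elliptic curve `E/ℚ` of
conductor `N`: `log δ_{1,N}(E) ≤ ((1/12) N + (7/12) d(N²)) · (log N + 4 log N / log log N)`, where
`δ_{1,N}` is the degree of the optimal parametrisation `X₀(N) → A_{1,N}` (rendered: the degree of a
modular parametrisation datum at level `N = N_E` minimal among all data with the same newform).
Printed proof: Thm 5.5 (`δ ∣ ∏_{[χ] ≠ [χ₀]} η_{[χ₀]}([χ])`), the bound `log η(c) < #c (log N +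
4 log N / log log N)` (Sturm-type index `n_c < N³`, Deligne's bound, Robin's divisor bound) and
Prop 7.1 (`r_{1,N} ≤ N/12 + (7/12) d(N²) + 1`, G. Martin's dimension formula).
[cite: PastenShimura2024, Thm 7.2 (first display, D = 1; arXiv p. 26)] -/
def PastenShimura2024_thm_7_2_explicit : Prop :=
  ∀ (N : ℕ) [NeZero N] (W : WeierstrassCurve ℚ) [W.IsElliptic] (D : ModularParametrizationData W N),
    W.conductorNorm ℤ = N →
    (∀ (W' : WeierstrassCurve ℚ) [W'.IsElliptic] (D' : ModularParametrizationData W' N),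
        D'.f = D.f → D.modularDegree ≤ D'.modularDegree) →
      Real.log (D.modularDegree : ℝ) ≤
        ((1 / 12 : ℝ) * N + 7 / 12 * ((N ^ 2).divisors.card : ℝ)) *
          (Real.log N + 4 * Real.log N / Real.log (Real.log N))

/-- **Pasten 2024, Theorem 7.2, asymptotic clause, at `D = 1`.** "Given any `ε > 0`, for `N ≫_ε 1`
with an effective implicit constant, we have `log δ_{D,M} < (1/24 + ε) φ(D) M log N`" — at `D = 1`:
`log δ_{1,N} < (1/24 + ε) N log N` for `N ≥ N₁(ε)` (effectivity dropped), `δ_{1,N}` the optimal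
degree as in `PastenShimura2024_thm_7_2_explicit`. This is verbatim the hypothesis `hδ` of
`pasten_thm_7_5_of_modularity_of_optimalDegreeBound`. Printed proof: as the explicit clause, with
Murty's `n_c ≪_ε N^{1+ε}` (Lemma 11 of [MurtyBounds]) in place of `n_c < N³`.
[cite: PastenShimura2024, Thm 7.2 (second display, D = 1; arXiv p. 26)] -/
def PastenShimura2024_thm_7_2_asymptotic : Prop :=
  ∀ ε : ℝ, 0 < ε → ∃ N₁ : ℕ, ∀ (N : ℕ) [NeZero N] (W : WeierstrassCurve ℚ) [W.IsElliptic]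
    (D : ModularParametrizationData W N),
    (∀ (W' : WeierstrassCurve ℚ) [W'.IsElliptic] (D' : ModularParametrizationData W' N),
        D'.f = D.f → D.modularDegree ≤ D'.modularDegree) →
      N₁ ≤ N → Real.log (D.modularDegree : ℝ) < (1 / 24 + ε) * (N : ℝ) * Real.log N

/-- **Thm 7.5 (asymptotic discriminant clause) from Thm 7.2** (PROVED assembly of tree results): the
named fact `pasten_thm_7_5` (`log|Δ_E| < (1/4 + ε) N log N` for `N ≫_ε 1`) follows from modularity
with an integral Manin constant (`nonempty_modularParametrizationData`), Mazur–Kenku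
(`PastenShimura2024_minimalDegree_le_163_mul`) and Thm 7.2 (asymptotic, `D = 1`) — the printed
derivation "(EqDiscH) and (EqHDeg) together with our bounds for `δ_{D,M}` specialized to `D = 1`"
(§7.4), carried out in `PastenValuationProductThm75Proofs.lean`.
[cite: PastenShimura2024, Thm 7.5 (proof, §7.4, arXiv p. 27)] -/
theorem pasten_thm_7_5_of_thm_7_2 (hmod : nonempty_modularParametrizationData)
    (h163 : PastenShimura2024_minimalDegree_le_163_mul) (h72 : PastenShimura2024_thm_7_2_asymptotic) :
    pasten_thm_7_5 :=
  pasten_thm_7_5_of_modularity_of_optimalDegreeBound hmod h163 h72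

/-! ### Thm 7.5: the height clauses -/

/-- **Pasten 2024, Theorem 7.5, explicit height clause.** "For all elliptic curves `E` over `ℚ` of
conductor `N` we have `h(E) ≤ (1/24)(N + 7 d(N²))(log N + 4 log N / log log N) + 9`" (`h(E)` the
Faltings height, §3: `h(E) = −½ log((i/2)∫ ω_E ∧ ω̄_E)` — the tree's `WeierstrassCurve.faltingsHeight`;
`N = N_E ≥ 11`, so `log log N > 0`). Printed proof: (EqHDeg) `h(E) ≤ ½ log δ_{1,N} + 9` (§3) and
Thm 7.2 at `D = 1`. [cite: PastenShimura2024, Thm 7.5 (first display; arXiv p. 27)] -/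
def PastenShimura2024_thm_7_5_height_explicit : Prop :=
  ∀ (W : WeierstrassCurve ℚ) [W.IsElliptic],
    W.faltingsHeight ≤
      (1 / 24 : ℝ) * ((W.conductorNorm ℤ : ℝ) + 7 * (((W.conductorNorm ℤ) ^ 2).divisors.card : ℝ)) *
          (Real.log (W.conductorNorm ℤ) +
            4 * Real.log (W.conductorNorm ℤ) / Real.log (Real.log (W.conductorNorm ℤ))) + 9

/-- **Pasten 2024, Theorem 7.5, asymptotic height clause (unconditional).** "Furthermore, given
`ε > 0`, for `N ≫_ε 1` with an effective implicit constant we have `h(E) < (1/48 + ε) N log N`" — for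
ALL elliptic curves `E/ℚ` of conductor `N ≥ N₀(ε)` (effectivity dropped). The GRH clause
`(1/24 + ε) N log log N` is not recorded. [cite: PastenShimura2024, Thm 7.5 (third display; arXiv p. 27)] -/
def PastenShimura2024_thm_7_5_height : Prop :=
  ∀ ε : ℝ, 0 < ε → ∃ N₀ : ℕ, ∀ (W : WeierstrassCurve ℚ) [W.IsElliptic], N₀ ≤ W.conductorNorm ℤ →
    W.faltingsHeight < (1 / 48 + ε) * (W.conductorNorm ℤ : ℝ) * Real.log (W.conductorNorm ℤ)

/-- The asymptotic height clause of Thm 7.5 with `ε = 1` gives a bound of Murty–Pasten's 2013 shape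
`h(E) < c · N log N` (`c = 1/48 + 1 < 0.1 · 11`) for `N ≫ 1` — recorded as the comparison sentence
"we observe that these estimates are better than (1.2)" (§1.3, p. 7). PROVED from the named fact.
[cite: PastenShimura2024, §1.3 p. 7 (comparison with Murty–Pasten)] -/
theorem PastenShimura2024_thm_7_5_height.exists_lt_mul (h : PastenShimura2024_thm_7_5_height) :
    ∃ N₀ : ℕ, ∀ (W : WeierstrassCurve ℚ) [W.IsElliptic], N₀ ≤ W.conductorNorm ℤ →
      W.faltingsHeight < (49 / 48 : ℝ) * (W.conductorNorm ℤ : ℝ) * Real.log (W.conductorNorm ℤ) := by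
  obtain ⟨N₀, hN₀⟩ := h 1 one_pos
  refine ⟨N₀, fun W _ hN => ?_⟩
  have := hN₀ W hN
  norm_num at this ⊢
  exact this


/-! ### Murty–Pasten's asymptotic Thm 7.1 is superseded by Pasten's Thm 7.5 (appended, PROVED) -/

/-- **Murty–Pasten 2013, Thm 7.1 (asymptotic clauses) ⇐ Pasten 2024, Thm 7.5** (PROVED reduction of
one named fact to two sharper ones): `h(E) < (1/48 + 1/24) N log N ≤ (1/12) N log N` and
`log|Δ_E| < (1/4 + 1/2) N log N ≤ N log N` for `N ≫ 1`, so `MurtyPasten.height_discriminant_asymptotic`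
holds with `O`-constant `K = 0` granted `PastenShimura2024_thm_7_5_height` and `pasten_thm_7_5`
("we observe that these estimates are better than (1.2)", Pasten §1.3 p. 7).
[cite: PastenShimura2024, Thm 7.5 and §1.3 p. 7] [cite: MurtyPasten2013, Thm 7.1 (second part)] -/
theorem MurtyPasten.height_discriminant_asymptotic_of_pasten (hh : PastenShimura2024_thm_7_5_height)
    (hΔ : pasten_thm_7_5) : MurtyPasten.height_discriminant_asymptotic := by
  obtain ⟨N₁, hN₁⟩ := hh (1 / 24) (by norm_num)
  obtain ⟨N₂, hN₂⟩ := hΔ (1 / 2) (by norm_num)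
  refine ⟨0, max (max N₁ N₂) 1, fun W _ hN => ?_⟩
  have h1 := hN₁ W (le_trans (le_trans (le_max_left _ _) (le_max_left _ _)) hN)
  have h2 := hN₂ W (le_trans (le_trans (le_max_right _ _) (le_max_left _ _)) hN)
  have hN1 : (1 : ℝ) ≤ (W.conductorNorm ℤ : ℝ) := by
    exact_mod_cast le_trans (le_max_right _ _) hN
  have hlog : 0 ≤ Real.log (W.conductorNorm ℤ) := Real.log_nonneg hN1
  have hNlogN : 0 ≤ (W.conductorNorm ℤ : ℝ) * Real.log (W.conductorNorm ℤ) :=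
    mul_nonneg (by linarith) hlog
  constructor
  · nlinarith
  · nlinarith

end Literature.NumberTheory.EllipticCurves

end
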